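/-
Fleet lead `ym-wcr-19609-p1` (seat prover-ym-wcr-19609-p1-g2-0), route `WeakCouplingRates`, crux `BulkDominatesColdBoxW`
(stmt-QuantumFields-19609), line `dlr-chessboard` (v6): the «∃ ϑ s + energy ≤ 16(2H+3)⁴β^{2δ−1}» clause of the expansion interfaces, eventually in β.
-/
import Summits.QuantumFields.YangMills.Theorems.WeakCouplingRatesBulkDominatesColdBoxWDatumCompetitor
import Summits.QuantumFields.YangMills.Theorems.WeakCouplingRatesColdBoxTwoPointFloorWStubBoxKernelVsLattice
import Literature.MathematicalPhysics.QuantumFieldTheory.LatticeGaugeAsymptoticsFreeEnergyProofs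

/-!
# Crux `BulkDominatesColdBoxW`: the competitor energy bound in the LITERAL form of the interfaces — `≤ 16(2⌈β^θ⌉+3)⁴β^{2δ−1}`, eventually in `β`

`exists_datum_coords_energy_le` (`Theorems/WeakCouplingRatesBulkDominatesColdBoxWDatumCompetitor.lean`) bounds the three one-colour Maxwell energies of
the gnomonic coordinates of the forest-gauged truncated gauge copy `W` of a crude-good datum by `#P·(β^{2δ−1} + 362(√2 m₀)³)`, `m₀` the explicit
small-link radius.  Here the bookkeeping is finished: with `H = ⌈β^θ⌉`, `#P ≤ 6(2H+3)⁴` (`card_plaquettesIn_halfOpenBox_le`),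
`m₀ ≤ 34800·β^{3θ+δ−1/2}` and `9θ + δ < 1/2`, for `β ≥ β₀` one has `m₀ ≤ 1/6` and `362(√2m₀)³ ≤ (5/3)β^{2δ−1}`, whence

  `exists_datum_coords_energy_eventually`: `∃ β₀, ∀ β ≥ β₀, ∀ ω crude-good, ∃ g v, W = gnomonicChart ∘ v on the enlarged box,
  `Σ_c v_{e,c}² ≤ 3·10⁹·β^{6θ+2δ−1}` there, and `Σ_c M_{v_c}(v_c) ≤ 16(2H+3)⁴β^{2δ−1}`**

— exactly the energy clause of `KernelMeanExpansion θ δ` / `KernelCovExpansion A θ δ` (with `ϑ c = v_· c` the datum's chart coordinates and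
`s c = v_· c` on the free edges).  No new definition; standard axioms.  NOT a claim about the mass gap.
-/

set_option autoImplicit false

noncomputable section

open Finset
open scoped Matrix.Norms.L2Operator
open Literature.Probability.LatticeModels Literature.MathematicalPhysics Literature.MathematicalPhysics.QuantumLattice
open Literature.MathematicalPhysics.QuantumFieldTheory Literature.MathematicalPhysics.QuantumFieldTheory.AxialGauge
open Literature.MathematicalPhysics.QuantumFieldTheory.LatticeMaxwell
open Literature.MathematicalPhysics.QuantumFieldTheory.Balaban1983to89 Literature.MathematicalPhysics.QuantumFieldTheory.Balaban1983to89.UnitaryModel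

namespace Summit.QuantumFields.YangMills.Theorems.WeakCouplingRates

/-- `#P ≤ 6(2H+3)⁴` for the plaquette labels of the enlarged box. -/
theorem card_plaquettesIn_enlarged_le (H : ℕ) :
    ((plaquettesIn (halfOpenBox 4 (2 * H + 3))).card : ℝ) ≤ 6 * (2 * (H : ℝ) + 3) ^ 4 := by
  have h := ChatterjeeFreeEnergy.card_plaquettesIn_halfOpenBox_le (d := 4) (2 * H + 3)
  have hc : Fintype.card {q : Fin 4 × Fin 4 // q.1 < q.2} = 6 := by decide
  rw [hc] at h
  have h' : ((plaquettesIn (halfOpenBox 4 (2 * H + 3))).card : ℝ) ≤ ((2 * H + 3 : ℕ) : ℝ) ^ 4 * 6 := by exact_mod_cast h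
  push_cast at h'
  linarith

/-- The small-link radius is at most `34800·H³·β^{δ−1/2}` for `H ≥ 1`, `β > 0`. -/
theorem smallLinkRadius_le {H : ℕ} (hH : 1 ≤ H) {β δ : ℝ} (hβ : 0 < β) :
    (12 * (H : ℝ) ^ 2 + 2 * H + 1) *
        (Real.sqrt (2 * (16 * (4 * (2 * H + 3 : ℕ) * Real.sqrt (2 * β ^ (2 * δ - 1))) ^ 2)) +
          4 * (4 * (2 * H + 3 : ℕ) * Real.sqrt (2 * β ^ (2 * δ - 1)))) ≤
      34800 * (H : ℝ) ^ 3 * β ^ (δ - 1 / 2) := by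
  have hH1 : (1 : ℝ) ≤ H := by exact_mod_cast hH
  have hpow : 0 < β ^ (δ - 1 / 2) := Real.rpow_pos_of_pos hβ _
  -- `√(2β^{2δ−1}) = √2 · β^{δ−1/2}`
  have hsq : Real.sqrt (2 * β ^ (2 * δ - 1)) = Real.sqrt 2 * β ^ (δ - 1 / 2) := by
    have : β ^ (2 * δ - 1) = (β ^ (δ - 1 / 2)) ^ 2 := by
      rw [← Real.rpow_natCast, ← Real.rpow_mul hβ.le]; norm_num; ring_nf
    rw [this, Real.sqrt_mul (by norm_num : (0 : ℝ) ≤ 2), Real.sqrt_sq hpow.le]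
  set r₀ : ℝ := 4 * (2 * H + 3 : ℕ) * Real.sqrt (2 * β ^ (2 * δ - 1)) with hr₀
  have hr₀0 : 0 ≤ r₀ := by rw [hr₀]; positivity
  have h2 : Real.sqrt 2 ≤ 3 / 2 := by rw [Real.sqrt_le_left (by norm_num)]; norm_num
  have h2' : 0 ≤ Real.sqrt 2 := Real.sqrt_nonneg 2
  -- `r₀ ≤ 30 H β^{δ−1/2}`
  have hr₀le : r₀ ≤ 30 * (H : ℝ) * β ^ (δ - 1 / 2) := by
    rw [hr₀, hsq]; push_cast
    have : (4 * (2 * (H : ℝ) + 3)) * (Real.sqrt 2 * β ^ (δ - 1 / 2)) ≤ (4 * (5 * (H : ℝ))) * (3 / 2 * β ^ (δ - 1 / 2)) := by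
      gcongr; linarith
    linarith
  -- `√(2·16 r₀²) = 4√2 r₀ ≤ 6 r₀`
  clear_value r₀
  have hsqrt : Real.sqrt (2 * (16 * r₀ ^ 2)) ≤ 6 * r₀ := by
    have hs2 : (Real.sqrt 2) ^ 2 = 2 := Real.sq_sqrt (by norm_num : (0 : ℝ) ≤ 2)
    have heq : 2 * (16 * r₀ ^ 2) = (Real.sqrt 2 * (4 * r₀)) ^ 2 := by linear_combination (-(16 * r₀ ^ 2)) * hs2
    rw [heq, Real.sqrt_sq (by positivity)]
    nlinarith
  have hquad : 12 * (H : ℝ) ^ 2 + 2 * H + 1 ≤ 15 * (H : ℝ) ^ 2 := by nlinarith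
  calc (12 * (H : ℝ) ^ 2 + 2 * H + 1) * (Real.sqrt (2 * (16 * r₀ ^ 2)) + 4 * r₀)
      ≤ (15 * (H : ℝ) ^ 2) * (10 * r₀) := by
        apply mul_le_mul hquad (by linarith) (by positivity) (by positivity)
    _ ≤ (15 * (H : ℝ) ^ 2) * (10 * (30 * (H : ℝ) * β ^ (δ - 1 / 2))) := by gcongr
    _ = 4500 * (H : ℝ) ^ 3 * β ^ (δ - 1 / 2) := by ring
    _ ≤ 34800 * (H : ℝ) ^ 3 * β ^ (δ - 1 / 2) := by nlinarith [pow_pos (show (0:ℝ) < H by linarith) 3]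

/-- **The energy clause of the expansion interfaces, eventually in `β`.**  For `0 < θ`, `0 ≤ δ` with `9θ + δ < 1/2` there is `β₀` such that
for every `β ≥ β₀` and every datum `ω` crude-good at scale `β^{2δ−1}` for the box `H = ⌈β^θ⌉`, there are a gauge `g` and gnomonic coordinates
`v` of the forest-gauged truncated gauge copy `W` (chart points on the enlarged box, coordinates of size `Σ_c v_{e,c}² ≤ 2·278400²·β^{6θ+2δ−1}`)
whose three one-colour Maxwell energies satisfy `Σ_c M_{v_c}(v_c) ≤ 16(2H+3)⁴β^{2δ−1}` — the literal energy clause of `KernelMeanExpansion θ δ` and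
`KernelCovExpansion A θ δ`. -/
theorem exists_datum_coords_energy_eventually {θ δ : ℝ} (hθ : 0 < θ) (hδ : 0 ≤ δ) (hwin : 9 * θ + δ < 1 / 2) :
    ∃ β₀ : ℝ, ∀ β : ℝ, β₀ ≤ β → ∀ ω : LGConfig 4 (Matrix.specialUnitaryGroup (Fin 2) ℂ), CrudeGood β δ ⌈β ^ θ⌉₊ ω →
      ∃ (g : Site 4 → Matrix.specialUnitaryGroup (Fin 2) ℂ) (v : Literature.MathematicalPhysics.QuantumLattice.ZdEdge 4 → Fin 3 → ℝ),
        (∀ e ∈ boxEdgesAt dirCorner (2 * ⌈β ^ θ⌉₊ + 3),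
          forestFix ⌈β ^ θ⌉₊ (glueWith (boxEdgesAt dirCorner (2 * ⌈β ^ θ⌉₊ + 3))
            (fun e' : ↥(boxEdgesAt dirCorner (2 * ⌈β ^ θ⌉₊ + 3)) => gaugeTransformZd g ω e'.1) (fun _ => 1)) e = gnomonicChart (v e)) ∧
        (∀ e ∈ boxEdgesAt dirCorner (2 * ⌈β ^ θ⌉₊ + 3), ∑ c, v e c ^ 2 ≤ 2 * 278400 ^ 2 * β ^ (6 * θ + 2 * δ - 1)) ∧
        ∑ c : Fin 3, formM (fun e => e ∉ dirFreeEdges ⌈β ^ θ⌉₊) dirCorner (2 * ⌈β ^ θ⌉₊ + 3) (fun e => v e c)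
            (fun e' : DirFree ⌈β ^ θ⌉₊ => v e'.1.1 c) ≤
          16 * (2 * (⌈β ^ θ⌉₊ : ℝ) + 3) ^ 4 * β ^ (2 * δ - 1) := by
  set M : ℝ := 278400 with hM
  have he1 : 0 < 1 / 2 - 3 * θ - δ := by linarith
  have he2 : 0 < 1 / 2 - 9 * θ - δ := by linarith
  refine ⟨max 1 (max ((6 * M) ^ (1 / (1 / 2 - 3 * θ - δ))) ((760 * M ^ 3) ^ (1 / (1 / 2 - 9 * θ - δ)))), fun β hβ ω hω => ?_⟩
  have hβ1 : (1 : ℝ) ≤ β := le_trans (le_max_left _ _) hβ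
  have hβ0 : 0 < β := by linarith
  have hA : 6 * M ≤ β ^ (1 / 2 - 3 * θ - δ) :=
    le_rpow_of_root_le (by rw [hM]; norm_num) he1 (le_trans (le_trans (le_max_left _ _) (le_max_right _ _)) hβ)
  have hB : 760 * M ^ 3 ≤ β ^ (1 / 2 - 9 * θ - δ) :=
    le_rpow_of_root_le (by rw [hM]; norm_num) he2 (le_trans (le_trans (le_max_right _ _) (le_max_right _ _)) hβ)
  set H : ℕ := ⌈β ^ θ⌉₊ with hHdef
  obtain ⟨hH1, hH2⟩ := one_le_ceil_rpow_and_le hβ1 hθ.le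
  rw [← hHdef] at hH1 hH2
  have hH : 1 ≤ H := by exact_mod_cast hH1
  -- the small-link radius
  set m₀ : ℝ := (12 * (H : ℝ) ^ 2 + 2 * H + 1) *
      (Real.sqrt (2 * (16 * (4 * (2 * H + 3 : ℕ) * Real.sqrt (2 * β ^ (2 * δ - 1))) ^ 2)) +
        4 * (4 * (2 * H + 3 : ℕ) * Real.sqrt (2 * β ^ (2 * δ - 1)))) with hm₀
  have hm₀0 : 0 ≤ m₀ := by rw [hm₀]; positivity
  have hH3 : (H : ℝ) ^ 3 ≤ 8 * β ^ (3 * θ) := by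
    have h := pow_le_pow_left₀ (by linarith : (0 : ℝ) ≤ H) hH2 3
    have e : (2 * β ^ θ) ^ 3 = 8 * β ^ (3 * θ) := by
      rw [mul_pow, show (3 : ℝ) * θ = θ * ((3 : ℕ) : ℝ) by push_cast; ring, Real.rpow_mul_natCast hβ0.le]; norm_num
    rwa [e] at h
  have hm₀le : m₀ ≤ M * β ^ (3 * θ + δ - 1 / 2) := by
    have h1 : m₀ ≤ 34800 * (H : ℝ) ^ 3 * β ^ (δ - 1 / 2) := smallLinkRadius_le hH hβ0
    have hpos : 0 ≤ β ^ (δ - 1 / 2) := Real.rpow_nonneg hβ0.le _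
    have h2 : 34800 * (H : ℝ) ^ 3 * β ^ (δ - 1 / 2) ≤ 34800 * (8 * β ^ (3 * θ)) * β ^ (δ - 1 / 2) := by gcongr
    have e : 34800 * (8 * β ^ (3 * θ)) * β ^ (δ - 1 / 2) = M * β ^ (3 * θ + δ - 1 / 2) := by
      rw [hM, show 3 * θ + δ - 1 / 2 = 3 * θ + (δ - 1 / 2) by ring, Real.rpow_add hβ0]; ring
    linarith
  -- (A) `m₀ ≤ 1/6`
  have hexpA : β ^ (3 * θ + δ - 1 / 2) * β ^ (1 / 2 - 3 * θ - δ) = 1 := by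
    rw [← Real.rpow_add hβ0]; ring_nf; exact Real.rpow_zero β
  have hposA : 0 < β ^ (3 * θ + δ - 1 / 2) := Real.rpow_pos_of_pos hβ0 _
  have hm₀6 : m₀ ≤ 1 / 6 := by
    have : M * β ^ (3 * θ + δ - 1 / 2) ≤ 1 / 6 := by
      have h := mul_le_mul_of_nonneg_left hA hposA.le
      rw [show β ^ (3 * θ + δ - 1 / 2) * (6 * M) = 6 * (M * β ^ (3 * θ + δ - 1 / 2)) by ring, hexpA] at h
      linarith
    exact hm₀le.trans this
  -- the competitor
  obtain ⟨g, v, hW, hv, hE⟩ := exists_datum_coords_energy_le hH hω hm₀6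
  refine ⟨g, v, hW, fun e he => ?_, ?_⟩
  · have h := hv e he
    have hsq : m₀ ^ 2 ≤ (M * β ^ (3 * θ + δ - 1 / 2)) ^ 2 := pow_le_pow_left₀ hm₀0 hm₀le 2
    have e : (M * β ^ (3 * θ + δ - 1 / 2)) ^ 2 = M ^ 2 * β ^ (6 * θ + 2 * δ - 1) := by
      rw [mul_pow, show (6 : ℝ) * θ + 2 * δ - 1 = (3 * θ + δ - 1 / 2) * ((2 : ℕ) : ℝ) by push_cast; ring, Real.rpow_mul_natCast hβ0.le]
    rw [e] at hsq
    linarith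
  · -- (B) `362 (√2 m₀)³ ≤ (5/3) β^{2δ-1}`, then `#P ≤ 6(2H+3)⁴`
    have hP := card_plaquettesIn_enlarged_le H
    have hβpow : 0 < β ^ (2 * δ - 1) := Real.rpow_pos_of_pos hβ0 _
    have hs2 : Real.sqrt 2 ≤ 3 / 2 := by rw [Real.sqrt_le_left (by norm_num)]; norm_num
    have hcube : (Real.sqrt 2 * m₀) ^ 3 ≤ 27 / 8 * (M ^ 3 * β ^ (9 * θ + 3 * δ - 3 / 2)) := by
      have h1 : Real.sqrt 2 * m₀ ≤ 3 / 2 * (M * β ^ (3 * θ + δ - 1 / 2)) :=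
        mul_le_mul hs2 hm₀le hm₀0 (by norm_num)
      have h2 := pow_le_pow_left₀ (by positivity) h1 3
      have e : (3 / 2 * (M * β ^ (3 * θ + δ - 1 / 2))) ^ 3 = 27 / 8 * (M ^ 3 * β ^ (9 * θ + 3 * δ - 3 / 2)) := by
        rw [mul_pow, mul_pow, show (9 : ℝ) * θ + 3 * δ - 3 / 2 = (3 * θ + δ - 1 / 2) * ((3 : ℕ) : ℝ) by push_cast; ring,
          Real.rpow_mul_natCast hβ0.le]
        norm_num
      rw [e] at h2
      have : 0 ≤ M ^ 3 * β ^ (9 * θ + 3 * δ - 3 / 2) := by positivity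
      linarith
    have hexpB : β ^ (9 * θ + 3 * δ - 3 / 2) * β ^ (1 / 2 - 9 * θ - δ) = β ^ (2 * δ - 1) := by
      rw [← Real.rpow_add hβ0]; ring_nf
    have hrem : 362 * (Real.sqrt 2 * m₀) ^ 3 ≤ 5 / 3 * β ^ (2 * δ - 1) := by
      have hpos9 : 0 ≤ β ^ (9 * θ + 3 * δ - 3 / 2) := Real.rpow_nonneg hβ0.le _
      have h := mul_le_mul_of_nonneg_left hB hpos9
      rw [hexpB] at h
      -- `760 M³ β^{9θ+3δ−3/2} ≤ β^{2δ−1}` and `362·(27/8) = 1221.75 ≤ (5/3)·760`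
      have hMpos : 0 ≤ M ^ 3 * β ^ (9 * θ + 3 * δ - 3 / 2) := by positivity
      nlinarith [hcube, hMpos]
    calc ∑ c : Fin 3, formM (fun e => e ∉ dirFreeEdges H) dirCorner (2 * H + 3) (fun e => v e c) (fun e' : DirFree H => v e'.1.1 c)
        ≤ ((plaquettesIn (halfOpenBox 4 (2 * H + 3))).card : ℝ) * (β ^ (2 * δ - 1) + 362 * (Real.sqrt 2 * m₀) ^ 3) := hE
      _ ≤ (6 * (2 * (H : ℝ) + 3) ^ 4) * (β ^ (2 * δ - 1) + 5 / 3 * β ^ (2 * δ - 1)) := by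
          apply mul_le_mul hP (by linarith) (by positivity) (by positivity)
      _ = 16 * (2 * (H : ℝ) + 3) ^ 4 * β ^ (2 * δ - 1) := by ring

end Summit.QuantumFields.YangMills.Theorems.WeakCouplingRates

end
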